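import Summits.AtomisticToContinuum.HydrodynamicLimit.Theorems.MourreKoopmanChargesLinearToEntropyInBandDefsB
import Summits.AtomisticToContinuum.HydrodynamicLimit.Theorems.MourreKoopmanChargesLinearToEntropyInBandFastThroughputWOfEnvelope
import Summits.AtomisticToContinuum.HydrodynamicLimit.Theses.BGEndpointRigidity
import HarnessLib

/-!
# Crux `MourreKoopmanCharges.LinearToEntropyInBand` (stmt-AtomisticToContinuum-17740), line `registered`:
# wave-5 glue — skeleton v7's stub 4a-iii PROVED: what the Lanford envelope delivers per window

Helper file (`--supports stmt-AtomisticToContinuum-17740`).  Skeleton v7 splits the XL window-clause stub 4a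
of v6 into 4a-i (visible one-block estimate), 4a-ii (Yau bookkeeping with the visible/invisible split) and
4a-iii, the PER-WINDOW inputs the Lanford pair envelope of the true law delivers
(`work/stubs/w4/V7-STUBS.md` §4a-iii):

  `stub_throughputOfEnvelopeR : ∀ η > 0, LanfordEnvelopeR → FastCollisionThroughputW η ∧ MeanWindowTransferActivityBelow η`.

* The FIRST conjunct is p160336's `glue_fastCollisionThroughputW_inBand_of_lanfordEnvelopeR`, whose inline-expanded
  conclusion is the body of the DefsB object `FastCollisionThroughputW η` (definitionally).
* The SECOND conjunct is new here, `glue_meanWindowTransferActivity_of_lanfordEnvelopeR` (registered glue):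
  `LanfordEnvelopeR → ∀ η, MeanWindowTransferActivityBelow η` — the per-window MEAN transfer activity
  `E[(N+1)⁻¹ Σᵢ actᵢ] ≤ C`, `actᵢ = (σ/τ) Σ_{collisions c of i, c.time ∈ (s, s + w]} (‖Δvᵢ‖ + |Δ‖vᵢ‖²|/2)`,
  `w = τ (N+1)^{-1/3}`, with a `τ`-FREE constant `C` (as the object demands: `∃ C ∀ τ > 0 ∃ N₀`).  Proof = the
  computation of p158163/p158600 on ONE window: the pair conjunct of `CollisionRate.stub_marginalEnvelopeLG_of_lanfordEnvelopeR`
  on the horizon `[0, t + 1]` (constant `Cₑ`, Gaussian `N(u', θ')`); the pathwise bookkeeping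
  `ofReal_sum_collisionSum_le_finsum_mark` (Prep §2) with the SUMMED mark `b(v, w) = ‖v − w‖ + ‖v − w‖ (‖v‖ + ‖w‖)`
  dominating the record functional (Prep §1: `norm_ofConfig_postVel_sub_preVel_le`, `abs_energyJump_ofConfig_le`);
  the non-stationary one-window / Campbell inequality `lintegral_windowCollisionSum_le_of_pairEnvelope`
  (`≤ 4 Cₑ w (N+1)² ε_N² · ∫ ‖w − v‖ b`); the Gaussian flux `J = J₁ + J₂` of the two marks
  (`mmr_lintegral_norm_sub_sq_prod_gaussMeasure_le`, `mmr_lintegral_energyMark_prod_gaussMeasure_le`); and the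
  normalisation `(N+1)⁻¹ (σ/τ) · 4 Cₑ (τ ν_N) (N+1)² ε_N² J = 4 Cₑ σ³ J`, `ν_N = (N+1)^{-1/3}`, `ε_N = σ ν_N` — free
  of `τ, N, s`; `N₀(τ)` makes `τ ν_N ≤ 1` (the window stays in the horizon) and exceeds the envelope's threshold.
  The packing guard, the Euler solution and the initial convergence are not used.
* `stub_throughputOfEnvelopeR` (registered, v7 stub 4a-iii) is the pair.

No definitions; nothing here restates the crux, the route's items or the Statement; `LanfordEnvelopeR`
(stmt-13677, OPEN) enters only as a hypothesis.  References: C. Cercignani, R. Illner, M. Pulvirenti, *The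
Mathematical Theory of Dilute Gases* (1994) §4.2, App. 4.A; H.-T. Yau, Lett. Math. Phys. 22 (1991) §2;
S. Olla, S. R. S. Varadhan, H.-T. Yau, Comm. Math. Phys. 155 (1993) §3.
-/

noncomputable section

open MeasureTheory Filter Set Topology
open scoped ENNReal InnerProductSpace BigOperators

namespace Summit.AtomisticToContinuum.HydrodynamicLimit.Theorems.LTEInBand

open Literature.Analysis.FluidPDE Literature.MathematicalPhysics.KineticTheory
open Summit.AtomisticToContinuum.HydrodynamicLimit.Theses
open Summit.AtomisticToContinuum.HydrodynamicLimit.Theorems.RestartPrinciple.AgeDuhamelForgetting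
  (mmr_lintegral_energyMark_prod_gaussMeasure_le mmr_lintegral_norm_sub_sq_prod_gaussMeasure_le)

/-! ## §1 The Gaussian flux of the summed mark -/

/-- The Gaussian-type flux integral of the SUMMED mark `b(v, w) = ‖v − w‖ + ‖v − w‖ (‖v‖ + ‖w‖)` (momentum jump
plus energy jump of the first partner, Prep §1) is at most `J₁ + J₂`, `J₁ = 4 (3θ + ‖u‖²)`,
`J₂ = 8 (1 + 8 (‖u‖⁴ + 15 θ²))` (the two landed Gaussian flux moments, added). -/
theorem lintegral_summedMarkFlux_prod_gaussMeasure_le (u : V3) {θ : ℝ} (hθ : 0 < θ) :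
    ∫⁻ p, ENNReal.ofReal ‖p.2 - p.1‖ * ENNReal.ofReal (‖p.1 - p.2‖ + ‖p.1 - p.2‖ * (‖p.1‖ + ‖p.2‖))
        ∂((gaussMeasure u θ).prod (gaussMeasure u θ)) ≤
      ENNReal.ofReal (4 * (3 * θ + ‖u‖ ^ 2) + 8 * (1 + 8 * (‖u‖ ^ 4 + 15 * θ ^ 2))) := by
  have hsplit : ∀ p : V3 × V3,
      ENNReal.ofReal ‖p.2 - p.1‖ * ENNReal.ofReal (‖p.1 - p.2‖ + ‖p.1 - p.2‖ * (‖p.1‖ + ‖p.2‖)) =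
        ENNReal.ofReal ‖p.2 - p.1‖ * ENNReal.ofReal ‖p.1 - p.2‖ +
          ENNReal.ofReal ‖p.2 - p.1‖ * ENNReal.ofReal (‖p.1 - p.2‖ * (‖p.1‖ + ‖p.2‖)) := fun p => by
    rw [ENNReal.ofReal_add (norm_nonneg _) (by positivity), mul_add]
  rw [lintegral_congr hsplit, lintegral_add_left (by fun_prop), ENNReal.ofReal_add (by positivity) (by positivity)]
  exact add_le_add (mmr_lintegral_norm_sub_sq_prod_gaussMeasure_le u hθ)
    (mmr_lintegral_energyMark_prod_gaussMeasure_le u hθ)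

/-! ## §2 The registered glue: per-window mean transfer activity from the Lanford envelope -/

/-- **Wave-5 glue, BY NAME (registered `glue_meanWindowTransferActivity_of_lanfordEnvelopeR`): the per-window MEAN
transfer activity `MeanWindowTransferActivityBelow η` holds for EVERY packing level `η` under the crux item
`Theses.BGEndpointRigidity.LanfordEnvelopeR`** (stmt-13677, OPEN; the guard is ignored).  Given `t < T`: the pair
conjunct of `CollisionRate.stub_marginalEnvelopeLG_of_lanfordEnvelopeR` on the horizon `[0, t + 1]` (constant `Cₑ`,
Gaussian `N(u', θ')`), `C := 4 Cₑ σ³ (J₁ + J₂)` BEFORE `τ`; for `τ > 0`, `N₀(τ)` = the envelope's threshold and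
`τ (N+1)^{-1/3} ≤ 1`; then per window `(s, s + w]`, `s ∈ [0, t]`: pull out `(N+1)⁻¹ σ/τ`, bound the summed
activities pathwise by the contact-pair sum of the summed mark (`ofReal_sum_collisionSum_le_finsum_mark`, Prep §1
kinematics), take means with `lintegral_windowCollisionSum_le_of_pairEnvelope`, integrate the mark
(`lintegral_summedMarkFlux_prod_gaussMeasure_le`), and normalise `(N+1)⁻¹ (σ/τ) 4 Cₑ w (N+1)² ε_N² = 4 Cₑ σ³`.
[cite: CIP1994, App. 4.A] -/
theorem glue_meanWindowTransferActivity_of_lanfordEnvelopeR : Summit.AtomisticToContinuum.HydrodynamicLimit.Theses.BGEndpointRigidity.LanfordEnvelopeR → ∀ η : ℝ, Summit.AtomisticToContinuum.HydrodynamicLimit.Theorems.LTEInBand.MeanWindowTransferActivityBelow η := by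
  intro hL η a₀ θ₀ u₀ ha hθ hu ha0 hθ0
  obtain ⟨σ₀, hσ₀, hA⟩ := CollisionRate.stub_marginalEnvelopeLG_of_lanfordEnvelopeR hL a₀ θ₀ u₀ ha hθ hu ha0 hθ0
  refine ⟨σ₀, hσ₀, fun σ hσ hσlt T ρ θ u _hE _hguard Φ _hlim t ht => ?_⟩
  have hτh : (0 : ℝ) < t + 1 := by linarith [ht.1]
  -- the pair envelope of the true law on the horizon `[0, t + 1]`
  obtain ⟨Ce, hCe, u', θ', hθ', N₁, hN₁⟩ := hA σ hσ hσlt Φ (t + 1) hτh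
  -- the Gaussian flux of the summed mark and the `τ`-free constant
  set J : ℝ := 4 * (3 * θ' + ‖u'‖ ^ 2) + 8 * (1 + 8 * (‖u'‖ ^ 4 + 15 * θ' ^ 2)) with hJdef
  have hJ0 : 0 ≤ J := by positivity
  refine ⟨4 * Ce * σ ^ 3 * J, by positivity, fun τ hτ => ?_⟩
  -- the threshold in `N`: the envelope's, and `τ ν_N ≤ 1`
  have hν : Tendsto (fun N : ℕ => ((N : ℝ) + 1) ^ (-(1 / 3 : ℝ))) atTop (𝓝 0) :=
    (tendsto_rpow_neg_atTop (by norm_num : (0 : ℝ) < 1 / 3)).comp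
      (tendsto_atTop_add_const_right _ 1 tendsto_natCast_atTop_atTop)
  obtain ⟨N₂, hN₂⟩ := eventually_atTop.1 (hν.eventually_le_const (inv_pos.2 hτ))
  refine ⟨max N₁ N₂, fun N hN s hs => ?_⟩
  dsimp only
  have hNN1 : N₁ ≤ N := (le_max_left _ _).trans hN
  have hNN2 : N₂ ≤ N := (le_max_right _ _).trans hN
  have hN0 : (0 : ℝ) < (N : ℝ) + 1 := by positivity
  set ν : ℝ := ((N : ℝ) + 1) ^ (-(1 / 3 : ℝ)) with hνdef
  have hν0 : 0 < ν := Real.rpow_pos_of_pos hN0 _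
  have hτν : 0 < τ * ν := mul_pos hτ hν0
  have hτν1 : τ * ν ≤ 1 := by
    have h := hN₂ N hNN2
    rw [← hνdef] at h
    calc τ * ν ≤ τ * τ⁻¹ := mul_le_mul_of_nonneg_left h hτ.le
      _ = 1 := mul_inv_cancel₀ hτ.ne'
  -- the true law is carried by the good set; its pair envelope at the times of the window
  have hPgood : localGibbsLaw σ a₀ u₀ θ₀ N (Φ N) (Φ N).goodᶜ = 0 := by
    rw [localGibbsLaw_eq]
    exact localGibbsMeasure_absolutelyContinuous σ _ _ _ N (Φ N) (Φ N).measure_compl_good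
  have hgood : ∀ᵐ z ∂(localGibbsLaw σ a₀ u₀ θ₀ N (Φ N)), z ∈ (Φ N).good := mem_ae_iff.2 hPgood
  have henv : ∀ r ∈ Set.Icc s (s + τ * ν), ∀ i j : Fin (N + 1), i ≠ j →
      ∀ f : (T3 × V3) × (T3 × V3) → ℝ≥0∞, Measurable f →
      ∫⁻ z, f ((Φ N).flow r z i, (Φ N).flow r z j) ∂(localGibbsLaw σ a₀ u₀ θ₀ N (Φ N)) ≤
        ENNReal.ofReal Ce * ∫⁻ q, f q ∂(((volume : Measure T3).prod (gaussMeasure u' θ')).prod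
          ((volume : Measure T3).prod (gaussMeasure u' θ'))) :=
    fun r hr i j hij f hf =>
      (hN₁ N hNN1 r ⟨hs.1.trans hr.1, hr.2.trans (by linarith [hs.2])⟩).1 i j hij f hf
  -- the summed mark dominates the record functional (Prep §1 kinematics)
  have hb0 : ∀ p : V3 × V3, 0 ≤ ‖p.1 - p.2‖ + ‖p.1 - p.2‖ * (‖p.1‖ + ‖p.2‖) := fun p => by positivity
  have hgb : ∀ (y : Config (N + 1) (Fin 3) T3) (t' : ℝ) (k l : Fin (N + 1)), k ≠ l →
      ‖(HardSphereCollisionRecord.ofConfig (Torus.geometry (Fin 3)) (hsDiameter σ N) y t' k l).postVel.1 -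
          (HardSphereCollisionRecord.ofConfig (Torus.geometry (Fin 3)) (hsDiameter σ N) y t' k l).preVel.1‖ +
        |‖(HardSphereCollisionRecord.ofConfig (Torus.geometry (Fin 3)) (hsDiameter σ N) y t' k l).postVel.1‖ ^ 2 -
          ‖(HardSphereCollisionRecord.ofConfig (Torus.geometry (Fin 3)) (hsDiameter σ N) y t' k l).preVel.1‖ ^ 2| / 2 ≤
      ‖(y k).2 - (y l).2‖ + ‖(y k).2 - (y l).2‖ * (‖(y k).2‖ + ‖(y l).2‖) :=
    fun y t' k l hkl => add_le_add (norm_ofConfig_postVel_sub_preVel_le _ _ y t' hkl)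
      (abs_energyJump_ofConfig_le _ _ y t' hkl)
  -- mean of the summed activities over the window: pathwise bookkeeping, Campbell, Gaussian flux
  have hstep : ∫⁻ z, ENNReal.ofReal (∑ i : Fin (N + 1),
      (Φ N).collisionSum (Set.Ioc s (s + τ * ν))
        (fun c => if c.fst = i then ‖c.postVel.1 - c.preVel.1‖ + |‖c.postVel.1‖ ^ 2 - ‖c.preVel.1‖ ^ 2| / 2
          else 0) z) ∂(localGibbsLaw σ a₀ u₀ θ₀ N (Φ N)) ≤
      ENNReal.ofReal (4 * Ce * (τ * ν) * ((N + 1 : ℕ) : ℝ) ^ 2 * hsDiameter σ N ^ 2) * ENNReal.ofReal J :=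
    calc _ ≤ _ := lintegral_mono_ae (hgood.mono fun z hz =>
          ofReal_sum_collisionSum_le_finsum_mark (Φ N) hz
            (g := fun c => ‖c.postVel.1 - c.preVel.1‖ + |‖c.postVel.1‖ ^ 2 - ‖c.preVel.1‖ ^ 2| / 2)
            (b := fun p => ‖p.1 - p.2‖ + ‖p.1 - p.2‖ * (‖p.1‖ + ‖p.2‖)) hb0 hgb hτν.le)
      _ ≤ _ := CollisionEnergyExchangeMeanBound.lintegral_windowCollisionSum_le_of_pairEnvelope hσ (Φ N) _
          hPgood s hτν hCe (gaussMeasure u' θ') henv (b := fun p => ‖p.1 - p.2‖ + ‖p.1 - p.2‖ * (‖p.1‖ + ‖p.2‖))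
          (by fun_prop)
      _ ≤ _ := mul_le_mul' le_rfl (lintegral_summedMarkFlux_prod_gaussMeasure_le u' hθ')
  -- the normalisation `(N+1)⁻¹ (σ/τ) · 4 Cₑ (τ ν_N) (N+1)² ε_N² = 4 Cₑ σ³`
  have hnorm : τ * ν * ((N + 1 : ℕ) : ℝ) ^ 2 * hsDiameter σ N ^ 2 = τ * σ ^ 2 * ((N : ℝ) + 1) := by
    -- adapted from `fastCollisionThroughputWAt_of_pairEnvelope` (p160336)
    have hν3 : ν ^ 3 = ((N : ℝ) + 1)⁻¹ := by
      rw [hνdef, ← Real.rpow_natCast, ← Real.rpow_mul hN0.le,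
        show (-(1 / 3 : ℝ)) * ((3 : ℕ) : ℝ) = -1 by norm_num, Real.rpow_neg_one]
    have hcast : ((N + 1 : ℕ) : ℝ) = (N : ℝ) + 1 := by push_cast; ring
    have hεN : hsDiameter σ N = σ * ν := by
      rw [hνdef, hsDiameter]
      push_cast
      ring
    rw [hεN, hcast, show τ * ν * ((N : ℝ) + 1) ^ 2 * (σ * ν) ^ 2 = τ * σ ^ 2 * ((N : ℝ) + 1) ^ 2 * ν ^ 3 by ring,
      hν3]
    field_simp
  have hconst : ((N : ℝ) + 1)⁻¹ * (σ / τ) * (4 * Ce * (τ * ν) * ((N + 1 : ℕ) : ℝ) ^ 2 * hsDiameter σ N ^ 2 * J) =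
      4 * Ce * σ ^ 3 * J := by
    calc ((N : ℝ) + 1)⁻¹ * (σ / τ) * (4 * Ce * (τ * ν) * ((N + 1 : ℕ) : ℝ) ^ 2 * hsDiameter σ N ^ 2 * J)
        = ((N : ℝ) + 1)⁻¹ * (σ / τ) * (4 * Ce * J) * (τ * ν * ((N + 1 : ℕ) : ℝ) ^ 2 * hsDiameter σ N ^ 2) := by
          ring
      _ = 4 * Ce * σ ^ 3 * J := by
          rw [hnorm]
          field_simp
  have hc0 : (0 : ℝ) ≤ ((N : ℝ) + 1)⁻¹ * (σ / τ) := by positivity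
  have hw0 : (0 : ℝ) ≤ 4 * Ce * (τ * ν) * ((N + 1 : ℕ) : ℝ) ^ 2 * hsDiameter σ N ^ 2 := by positivity
  -- the chain
  calc ∫⁻ z, ENNReal.ofReal (((N : ℝ) + 1)⁻¹ * ∑ i : Fin (N + 1),
          σ / τ * (Φ N).collisionSum (Set.Ioc s (s + τ * ν))
            (fun c => if c.fst = i then ‖c.postVel.1 - c.preVel.1‖ + |‖c.postVel.1‖ ^ 2 - ‖c.preVel.1‖ ^ 2| / 2
              else 0) z) ∂(localGibbsLaw σ a₀ u₀ θ₀ N (Φ N))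
      = ENNReal.ofReal (((N : ℝ) + 1)⁻¹ * (σ / τ)) * ∫⁻ z, ENNReal.ofReal (∑ i : Fin (N + 1),
          (Φ N).collisionSum (Set.Ioc s (s + τ * ν))
            (fun c => if c.fst = i then ‖c.postVel.1 - c.preVel.1‖ + |‖c.postVel.1‖ ^ 2 - ‖c.preVel.1‖ ^ 2| / 2
              else 0) z) ∂(localGibbsLaw σ a₀ u₀ θ₀ N (Φ N)) := by
        rw [← lintegral_const_mul' _ _ ENNReal.ofReal_ne_top]
        refine lintegral_congr fun z => ?_
        rw [← ENNReal.ofReal_mul hc0, ← Finset.mul_sum, mul_assoc]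
    _ ≤ ENNReal.ofReal (((N : ℝ) + 1)⁻¹ * (σ / τ)) *
          (ENNReal.ofReal (4 * Ce * (τ * ν) * ((N + 1 : ℕ) : ℝ) ^ 2 * hsDiameter σ N ^ 2) * ENNReal.ofReal J) :=
        mul_le_mul' le_rfl hstep
    _ = ENNReal.ofReal (4 * Ce * σ ^ 3 * J) := by
        rw [← ENNReal.ofReal_mul hw0, ← ENNReal.ofReal_mul hc0, hconst]

/-! ## §3 Skeleton v7's stub 4a-iii, proved -/

/-- **Skeleton v7's stub 4a-iii `stub_throughputOfEnvelopeR` (registered), PROVED: what the Lanford envelope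
delivers per window.**  For every packing level `η > 0`, the crux item `Theses.BGEndpointRigidity.LanfordEnvelopeR`
(stmt-13677) gives BOTH per-window inputs of v7's Yau bookkeeping along guarded solutions: the fast-collision
throughput `FastCollisionThroughputW η` (p160336, `glue_fastCollisionThroughputW_inBand_of_lanfordEnvelopeR`, whose
conclusion is the object's body) and the mean transfer activity `MeanWindowTransferActivityBelow η`
(`glue_meanWindowTransferActivity_of_lanfordEnvelopeR`).  The positivity of `η` is not used. -/
theorem stub_throughputOfEnvelopeR : ∀ η : ℝ, 0 < η → Summit.AtomisticToContinuum.HydrodynamicLimit.Theses.BGEndpointRigidity.LanfordEnvelopeR → Summit.AtomisticToContinuum.HydrodynamicLimit.Theorems.LTEInBand.FastCollisionThroughputW η ∧ Summit.AtomisticToContinuum.HydrodynamicLimit.Theorems.LTEInBand.MeanWindowTransferActivityBelow η :=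
  fun η _ hL => ⟨glue_fastCollisionThroughputW_inBand_of_lanfordEnvelopeR hL η,
    glue_meanWindowTransferActivity_of_lanfordEnvelopeR hL η⟩

end Summit.AtomisticToContinuum.HydrodynamicLimit.Theorems.LTEInBand

end
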